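import Mathlib

/-!
# Chain calculus for crux `ElementaryWordLength.WordPerSuperQuartic`, line `Sketch`:
# the degree-one sum rule

In the chain normal form of a block word (`stub_chainNormalForm`,
`Theorems/ElementaryWordLengthWordPerSuperQuarticStubChainNormalForm.lean`) a word with `m`
variable letters for `E_02(P)` is an identity `Π_{t=1}^{m} (1 + x_{v_t} • N_t) = E_02(P − P(0))`
with constant square-zero `3 × 3` matrices `N_t`.  Expanding the product,
`Π_t (1 + x_{v_t} • N_t) = Σ_{T ⊆ [m]} x^{v(T)} · N_T` (`N_T` the ordered product over `T`), so the
identity is equivalent to the family of **sum rules** `Σ_{T : v(T) = μ} N_T = [x^μ]P · E_02` for every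
exponent vector `μ ≠ 0`.  This file proves the two lowest instances, which every rigidity argument
of the chain calculus (two-reads, the arc lemma of `Cruxes/WordPerSuperQuartic/Ideator1Notes.md` §2)
starts from:

* `chain_constantCoeff` — the constant term: `Π_t (1 + x_{v_t} • N_t)` has constant coefficient `1`;
* `chain_coeff_single` — the degree-one rule: the `x_i`-coefficient (entrywise) of the chain is the
  SUM of the matrices `N_t` over the letters `t` reading `x_i`;
* `chain_sum_reads_eq` — hence, for a chain computing `E_02(P')`, `Σ_{t : v_t = i} N_t = [x_i]P' · E_02`:
  the square-zero matrices read at one variable sum to a multiple of `E_02` (in particular a variable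
  read exactly once is read by `N = [x_i]P' · E_02` itself).
-/

-- `Summit.ValiantsHypothesis.ValiantsHypothesis.…` is the tree's mandated single-conjunct layout.
set_option linter.dupNamespace false

namespace Summit.ValiantsHypothesis.ValiantsHypothesis.Theorems.WordPerSuperQuartic

open MvPolynomial

/-- The constant coefficient of a chain `Π_t (1 + x_{v_t} • N_t)` is the identity matrix. -/
theorem chain_constantCoeff {σ : Type} (L : List (σ × Matrix (Fin 3) (Fin 3) ℂ)) :
    (constantCoeff : MvPolynomial σ ℂ →+* ℂ).mapMatrix
        (L.map (fun e => (1 : Matrix (Fin 3) (Fin 3) (MvPolynomial σ ℂ)) +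
          (X e.1 : MvPolynomial σ ℂ) • e.2.map (C : ℂ → MvPolynomial σ ℂ))).prod = 1 := by
  rw [map_list_prod, List.map_map, List.prod_eq_one]
  intro x hx
  obtain ⟨e, _, rfl⟩ := List.mem_map.1 hx
  rw [Function.comp_apply, map_add, map_one, add_eq_left]
  ext a b
  simp

/-- Entrywise constant coefficient of a chain: `δ_ab`. -/
theorem chain_constantCoeff_apply {σ : Type} (L : List (σ × Matrix (Fin 3) (Fin 3) ℂ))
    (a b : Fin 3) :
    constantCoeff ((L.map (fun e => (1 : Matrix (Fin 3) (Fin 3) (MvPolynomial σ ℂ)) +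
        (X e.1 : MvPolynomial σ ℂ) • e.2.map (C : ℂ → MvPolynomial σ ℂ))).prod a b) =
      (1 : Matrix (Fin 3) (Fin 3) ℂ) a b := by
  have h := congrFun (congrFun (chain_constantCoeff L) a) b
  rwa [RingHom.mapMatrix_apply, Matrix.map_apply] at h

/-- **Degree-one sum rule.**  The `x_i`-coefficient of the `(a,b)` entry of a chain
`Π_t (1 + x_{v_t} • N_t)` is the `(a,b)` entry of `Σ_{t : v_t = i} N_t`. -/
theorem chain_coeff_single {σ : Type} [DecidableEq σ] (L : List (σ × Matrix (Fin 3) (Fin 3) ℂ))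
    (i : σ) (a b : Fin 3) :
    coeff (Finsupp.single i 1) ((L.map (fun e => (1 : Matrix (Fin 3) (Fin 3) (MvPolynomial σ ℂ)) +
        (X e.1 : MvPolynomial σ ℂ) • e.2.map (C : ℂ → MvPolynomial σ ℂ))).prod a b) =
      (L.map (fun e => if e.1 = i then e.2 else 0)).sum a b := by
  have hne : (0 : σ →₀ ℕ) ≠ Finsupp.single i 1 := (Finsupp.single_ne_zero.mpr one_ne_zero).symm
  induction L generalizing a b with
  | nil =>
    simp only [List.map_nil, List.prod_nil, List.sum_nil, Matrix.zero_apply, Matrix.one_apply]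
    split_ifs <;> simp [coeff_one, hne]
  | cons e L ih =>
    simp only [List.map_cons, List.prod_cons, List.sum_cons]
    rw [Matrix.add_mul, Matrix.one_mul, Matrix.add_apply, coeff_add, ih, Matrix.add_apply,
      add_comm]
    congr 1
    rw [Matrix.smul_mul, Matrix.smul_apply, smul_eq_mul, Matrix.mul_apply, coeff_X_mul']
    by_cases hvi : e.1 = i
    · subst hvi
      rw [if_pos (by simp), if_pos rfl, tsub_self, coeff_sum]
      simp only [Matrix.map_apply, coeff_C_mul, ← constantCoeff_eq, chain_constantCoeff_apply,
        Matrix.one_apply, mul_ite, mul_one, mul_zero, Finset.sum_ite_eq', Finset.mem_univ,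
        if_true]
    · have hmem : e.1 ∉ (Finsupp.single i 1).support := by
        rw [Finsupp.mem_support_iff, Finsupp.single_apply, if_neg (Ne.symm hvi)]
        exact fun h => h rfl
      rw [if_neg hmem, if_neg hvi, Matrix.zero_apply]

/-- **Sum rule at a variable.**  If a chain computes `E_02(P')`, the square-zero matrices read at
the variable `x_i` sum to `[x_i]P' · E_02` (registered helper of stub `stub_chainHardness`). -/
theorem chain_sum_reads_eq : ∀ {σ : Type} [DecidableEq σ] (L : List (σ × Matrix (Fin 3) (Fin 3) ℂ)) (P' : MvPolynomial σ ℂ), (L.map (fun e => (1 : Matrix (Fin 3) (Fin 3) (MvPolynomial σ ℂ)) + (MvPolynomial.X e.1 : MvPolynomial σ ℂ) • e.2.map (MvPolynomial.C : ℂ → MvPolynomial σ ℂ))).prod = Matrix.transvection (0 : Fin 3) 2 P' → ∀ i : σ, (L.map (fun e => if e.1 = i then e.2 else 0)).sum = Matrix.single (0 : Fin 3) 2 (MvPolynomial.coeff (Finsupp.single i 1) P') := by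
  intro σ _ L P' h i
  have hne : (0 : σ →₀ ℕ) ≠ Finsupp.single i 1 := (Finsupp.single_ne_zero.mpr one_ne_zero).symm
  ext a b
  rw [← chain_coeff_single L i a b, h]
  simp only [Matrix.transvection, Matrix.add_apply, Matrix.one_apply, Matrix.single_apply,
    coeff_add]
  split_ifs <;> simp [coeff_one, hne]

end Summit.ValiantsHypothesis.ValiantsHypothesis.Theorems.WordPerSuperQuartic
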